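import Mathlib.Geometry.Euclidean.Angle.Unoriented.Basic
import Mathlib.Analysis.SpecialFunctions.Complex.Log
import Summits.AtomisticToContinuum.Crystallization.Theorems.TwoCentreKissingKernelRobustTangencyBoundVertexStar
import HarnessLib

/-!
# `RobustTangencyBound` — corner algebra: facet corners as algebraic data, and the vertex
# condition in product form (helper, step (III) machinery)

Route `TwoCentreKissingKernel`, item `stmt-AtomisticToContinuum-12082`, blueprint (III) §5–6 ("diagonal form"):
every corner angle `φ` of a facet of the hull of a spherical code is determined ALGEBRAICALLY by
three inner products, and the vertex condition "the corners at `y` sum to `2π`" is a pair of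
POLYNOMIAL identities in the cosines and sines of the corners — so the polygon/cluster lemmas of the
case analysis reduce to the infeasibility of polynomial systems on boxes (kernel-checked interval
certificates, `Literature/Analysis/ValidatedNumerics`).

* `corner_package` — for unit `y, u, w` with `⟪y,u⟫², ⟪y,w⟫² < 1` and `φ = ∠(t_y u, t_y w)`:
  `D > 0`, `D² = (1 − ⟪y,u⟫²)(1 − ⟪y,w⟫²)`, `cos φ · D = ⟪u,w⟫ − ⟪y,u⟫⟪y,w⟫`, `sin φ ≥ 0`,
  `sin φ ² = 1 − cos φ ²` (with `D = ‖t_y u‖ ‖t_y w‖`);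
* `prod_cos_add_sin_mul_I_eq_one` — if real numbers `α_j` (`j ∈ s`) sum to `2π` then
  `Π_j (cos α_j + sin α_j · I) = 1` in `ℂ`;
* `vertex_product_eq_one` — at a point `y` of a finite set `X` of unit vectors with
  `0 ∈ interior (conv X)`, the corner angles `θ_c = 2π · ballFraction (dirCone (facet c) y)` of the
  facets through `y` satisfy `Π_c (cos θ_c + sin θ_c · I) = 1` (`sum_ballFraction_dirCone_vertex`).
-/

noncomputable section

namespace Summit.AtomisticToContinuum.Crystallization.Theorems

open Real RealInnerProductSpace InnerProductGeometry Literature.Geometry.DiscreteGeometry Finset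

/-- **Corner package.** For unit vectors `y, u, w` with `⟪y,u⟫², ⟪y,w⟫² < 1`, the corner angle
`φ = ∠(t_y u, t_y w)` between the tangent components at `y` satisfies, with
`D = ‖t_y u‖ · ‖t_y w‖`: `0 < D`, `D² = (1 − ⟪y,u⟫²)(1 − ⟪y,w⟫²)`, `cos φ · D = ⟪u,w⟫ − ⟪y,u⟫⟪y,w⟫`,
`0 ≤ sin φ` and `sin φ ^ 2 = 1 − cos φ ^ 2`. -/
theorem corner_package {y u w : EuclideanSpace ℝ (Fin 3)} (hy : ‖y‖ = 1) (hu : ‖u‖ = 1)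
    (hw : ‖w‖ = 1) (hyu : ⟪y, u⟫ ^ 2 < 1) (hyw : ⟪y, w⟫ ^ 2 < 1) :
    0 < ‖tangentProj y u‖ * ‖tangentProj y w‖ ∧
    (‖tangentProj y u‖ * ‖tangentProj y w‖) ^ 2 = (1 - ⟪y, u⟫ ^ 2) * (1 - ⟪y, w⟫ ^ 2) ∧
    Real.cos (angle (perpTo y u) (perpTo y w)) * (‖tangentProj y u‖ * ‖tangentProj y w‖) =
      ⟪u, w⟫ - ⟪y, u⟫ * ⟪y, w⟫ ∧
    0 ≤ Real.sin (angle (perpTo y u) (perpTo y w)) ∧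
    Real.sin (angle (perpTo y u) (perpTo y w)) ^ 2 =
      1 - Real.cos (angle (perpTo y u) (perpTo y w)) ^ 2 := by
  have hPu : ‖tangentProj y u‖ ^ 2 = 1 - ⟪y, u⟫ ^ 2 := norm_sq_tangentProj hy hu
  have hPw : ‖tangentProj y w‖ ^ 2 = 1 - ⟪y, w⟫ ^ 2 := norm_sq_tangentProj hy hw
  have hu0 : 0 < ‖tangentProj y u‖ := by
    rcases (norm_nonneg (tangentProj y u)).lt_or_eq with h | h
    · exact h
    · rw [← h] at hPu; nlinarith
  have hw0 : 0 < ‖tangentProj y w‖ := by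
    rcases (norm_nonneg (tangentProj y w)).lt_or_eq with h | h
    · exact h
    · rw [← h] at hPw; nlinarith
  have hD : 0 < ‖tangentProj y u‖ * ‖tangentProj y w‖ := mul_pos hu0 hw0
  refine ⟨hD, by rw [mul_pow, hPu, hPw], ?_, sin_angle_nonneg _ _, ?_⟩
  · rw [perpTo_eq_tangentProj hy, perpTo_eq_tangentProj hy, cos_angle,
      div_mul_cancel₀ _ hD.ne', inner_tangentProj y u w hy]
  · rw [Real.sin_sq]

/-- **Angles summing to `2π`, in product form.** If `Σ_{j ∈ s} α_j = 2π` then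
`Π_{j ∈ s} (cos α_j + sin α_j · I) = 1`. -/
theorem prod_cos_add_sin_mul_I_eq_one {ι : Type*} (s : Finset ι) (α : ι → ℝ)
    (hsum : ∑ j ∈ s, α j = 2 * π) :
    ∏ j ∈ s, ((Real.cos (α j) : ℂ) + (Real.sin (α j) : ℂ) * Complex.I) = 1 := by
  have h : ∀ j ∈ s, ((Real.cos (α j) : ℂ) + (Real.sin (α j) : ℂ) * Complex.I) =
      Complex.exp ((α j : ℂ) * Complex.I) := by
    intro j _
    rw [Complex.exp_mul_I, ← Complex.ofReal_cos, ← Complex.ofReal_sin]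
  rw [Finset.prod_congr rfl h, ← Complex.exp_sum, ← Finset.sum_mul, ← Complex.ofReal_sum, hsum]
  have : ((2 * π : ℝ) : ℂ) * Complex.I = 2 * π * Complex.I := by push_cast; ring
  rw [this, Complex.exp_two_pi_mul_I]

/-- **The vertex condition in product form.** For a finite set `X` of unit vectors with
`0 ∈ interior (conv X)` and `y ∈ X`, the corner angles
`θ_c = 2π · ballFraction 0 (dirCone (argmaxCone (facetNormals X) c) y)` of the facets `c` through `y`
satisfy `Π_c (cos θ_c + sin θ_c · I) = 1`. -/
theorem vertex_product_eq_one {X : Finset (EuclideanSpace ℝ (Fin 3))} (hX1 : ∀ z ∈ X, ‖z‖ = 1)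
    (h0 : (0 : EuclideanSpace ℝ (Fin 3)) ∈ interior (convexHull ℝ (X : Set (EuclideanSpace ℝ (Fin 3)))))
    {y : EuclideanSpace ℝ (Fin 3)} (hy : y ∈ X) :
    ∏ c ∈ (facetNormals X).filter (fun c => ⟪c, y⟫ = 1),
      ((Real.cos (2 * π * ballFraction (0 : EuclideanSpace ℝ (Fin 3))
          (dirCone (argmaxCone (facetNormals X) c) y)) : ℂ) +
        (Real.sin (2 * π * ballFraction (0 : EuclideanSpace ℝ (Fin 3))
          (dirCone (argmaxCone (facetNormals X) c) y)) : ℂ) * Complex.I) = 1 := by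
  classical
  apply prod_cos_add_sin_mul_I_eq_one
  rw [← Finset.mul_sum, sum_ballFraction_dirCone_vertex hX1 h0 hy, mul_one]

end Summit.AtomisticToContinuum.Crystallization.Theorems

end
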